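import Literature.NumberTheory.LFunctions.CardonRobertsOrthogonality
import Literature.NumberTheory.LFunctions.CardonRobertsZeros
import Literature.NumberTheory.LFunctions.CardonRobertsSeparation
import Literature.NumberTheory.LFunctions.CardonRobertsConvergence
import Literature.Analysis.Moments.PolynomialDensityExpMoments
import Literature.NumberTheory.LFunctions.FordZetaZeroRecipSqSum
import Literature.NumberTheory.LFunctions.RiemannXiLogDeriv
import Literature.NumberTheory.LFunctions.RHWave0HardyProofs
import Literature.NumberTheory.LFunctions.WeilZeroSum
import HarnessLib

/-!
# RH-FREE · Cardon–Roberts' Lemma 3.5 `p_{2n}(z)/p_{2n}(0) → ∏_k (1 − z²/α_k²)` DISCHARGED (`CardonRoberts2006_lemma_3_5_holds`) — nothing here bears on the truth of RH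

Literature-typing tranche `rh-lit-broughan-2` (Broughan, *Equivalents of the Riemann Hypothesis*
Vol. 2, Thm 6.16; Cardon–Roberts, *An equivalence for the Riemann hypothesis in terms of
orthogonal polynomials*, J. Approx. Theory 138 (2006) 54–64, Lemma 3.5). This file proves the
tree's named fact `Literature.NumberTheory.LFunctions.CardonRoberts2006_lemma_3_5`
(`CardonRobertsOrthogonalPolynomials.lean`) by assembling the four RH-free layers

* A `CardonRobertsOrthogonality.lean` (Gram–Schmidt polynomials of an even measure),
* B1 `CardonRobertsZeros.lean` (real simple symmetric zeros, the product forms (17)),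
* B2 `CardonRobertsSeparation.lean` (CR Lemma 3.3 in counting form; `L²`-extremal inequalities),
* C `Literature/Analysis/Moments/PolynomialDensityExpMoments.lean` (polynomial density in `L²`
  of a discrete measure with an exponential moment — replaces CR's determinacy road, Lemmas
  2.4–2.7/3.2/3.4, which needs the Hamburger moment problem),
* D `CardonRobertsConvergence.lean` (CR Lemmas 3.4–3.5 in abstract form),

with the zeta-specific inputs of the tree: the zeros of `Ξ(z) = ξ(½ + iz)` with `Re z > 0`
correspond to the non-trivial zeros `ρ = ½ + iz` of `ζ` (`riemannXi_eq_zero_iff_holds`), their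
real parts are the ordinates `γ > 14` (`FordL33.fourteen_lt_abs_im`), the multiplicities agree
(`untop₀_meromorphicOrderAt_riemannXi`), `Σ m(ρ)/|ρ|² < ∞` (`FordL33.summable_order_div_norm_sq`),
there are infinitely many (`hardy_infinite_zeros_on_critical_line_holds`) but finitely many in
each box (`zetaZeroBox_finite`).

## Architecture (CR §3 pp. 61–63 and where the tree's road deviates)

1. §1 the zero set: countability, strip membership, `γ > 14`, multiplicity `= m(ρ) ≥ 1`, the
   spectrum `S = {Re z}` is infinite, locally finite, `Σ_{a∈S} a⁻² < ∞`, and the master bound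
   `Σ_z m(z) Re f(z) (Re z)^j e^{(c/2) Re z} < ∞` from `|f| < e^{−c Re z}`.
2. §2 `dF` as a countable sum of point masses at `±Re z` (index `zeros ⊕ zeros`), its integrals
   as `tsum`s, and the abstract hypotheses of layers A–B2 (`hmom`, `hae`, `hsym`, `hgap`, `hS`).
3. §3 **CR's `P_{2n}(a_k) → 0`** (in CR a consequence of Lemma 3.4; here its replacement):
   `P_{2n}(a)² · dF{a} ≤ a² ∫ (P_{2n}(x)/x)² dF ≤ a² ∫ ((1 − x²T)/x)² dF` for every `T` of degree
   `< 2n` (B2), and the right side is `< ε` for a suitable `T` (C with weights `dF{x}·x²`);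
   the odd case with weights `dF{x}·x⁴`.
4. §4 assembly: B1 gives `Z_n` with `p_{2n} = ∏_{x∈Z_n}(X² − x²)` and the ratio as the product
   (17); B2 gives the counting separation; §3 the vanishing; D the locally uniform convergence.

No new definitions, no named facts (D-0026); standard axioms only; nothing here bears on the
truth of RH.

## References

* [CardonRoberts2006] D. A. Cardon, S. A. Roberts, J. Approx. Theory 138 (2006) 54–64, §3.
* [Broughan2017] K. Broughan, *Equivalents of the Riemann Hypothesis* Vol. 2, CUP 2017, Thm 6.16.
* [Dunkl2001ReflectionGroups] C. F. Dunkl, Theorem 8 (density of polynomials under an exponential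
  moment).
-/

noncomputable section

open Complex MeasureTheory Filter Topology Polynomial

namespace Literature.NumberTheory.LFunctions

namespace CardonRobertsAssembly

/-! ## §1 The zeros of `Ξ` with positive real part versus the non-trivial zeros of `ζ` -/

/-- `Im(½ + iz) = Re z`. [folklore] -/
private theorem im_half_add (z : ℂ) : ((1 : ℂ) / 2 + I * z).im = z.re := by
  simp [mul_im]

/-- `Re(½ + iz) = ½ − Im z`. [folklore] -/
private theorem re_half_add (z : ℂ) : ((1 : ℂ) / 2 + I * z).re = 1 / 2 - z.im := by
  simp [mul_re]
  norm_num
  ring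

/-- A zero `z` of `Ξ` with `Re z > 0` gives the non-trivial zero `ρ = ½ + iz` of `ζ`
(`Ξ(z) = ξ(½+iz)` and `riemannXi_eq_zero_iff_holds`). [cite: CardonRoberts2006, §1 p. 55] -/
theorem half_add_mem_nontrivialZeros {z : ℂ} (hz : z ∈ cardonRobertsZeros) :
    (1 : ℂ) / 2 + I * z ∈ RHWave0.riemannZetaNontrivialZeros := by
  have h := (riemannXi_eq_zero_iff_holds ((1 : ℂ) / 2 + I * z)).1 hz.1
  exact ZetaZeros.riemannZetaNontrivialZeros.mem_of_re_pos h.1 h.2.1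

/-- The zeros of `Ξ` with `Re z > 0` have `Re z > 14` (their real parts are ordinates of
non-trivial zeros of `ζ`). [cite: CardonRoberts2006, §1 p. 55] -/
theorem fourteen_lt_re {z : ℂ} (hz : z ∈ cardonRobertsZeros) : 14 < z.re := by
  have h := FordL33.fourteen_lt_abs_im ⟨_, half_add_mem_nontrivialZeros hz⟩
  simp only [im_half_add] at h
  rwa [abs_of_pos hz.2] at h

/-- The zeros of `Ξ` with `Re z > 0` have `|Im z| < ½` ("let `ρ_k = α_k + iβ_k` … the Riemann
hypothesis is that all of the `ρ_k` are real"; `0 < Re(½+iz) < 1`). [cite: CardonRoberts2006, §1 p. 55] -/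
theorem abs_im_lt_half {z : ℂ} (hz : z ∈ cardonRobertsZeros) : |z.im| < 1 / 2 := by
  have h := (riemannXi_eq_zero_iff_holds ((1 : ℂ) / 2 + I * z)).1 hz.1
  rw [re_half_add] at h
  rw [abs_lt]
  constructor <;> linarith [h.2.1, h.2.2]

/-- The zeros of `Ξ` with `Re z > 0` lie in the Cardon–Roberts half-strip. [cite: CardonRoberts2006, §1 p. 55] -/
theorem mem_strip {z : ℂ} (hz : z ∈ cardonRobertsZeros) : z ∈ cardonRobertsStrip :=
  ⟨hz.2.le, (abs_im_lt_half hz).le⟩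

/-- The set of zeros of `Ξ` with positive real part is countable (it injects into the zero set
of `ζ`). [cite: CardonRoberts2006, §1 p. 55] -/
theorem countable_cardonRobertsZeros : cardonRobertsZeros.Countable := by
  have hsub : cardonRobertsZeros ⊆
      (fun s : ℂ ↦ -I * (s - 1 / 2)) '' RHWave0.riemannZetaNontrivialZeros := by
    intro z hz
    refine ⟨(1 : ℂ) / 2 + I * z, half_add_mem_nontrivialZeros hz, ?_⟩
    have hI : -I * I = (1 : ℂ) := by rw [neg_mul, I_mul_I, neg_neg]
    show -I * ((1 : ℂ) / 2 + I * z - 1 / 2) = z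
    rw [show (1 : ℂ) / 2 + I * z - 1 / 2 = I * z by ring, ← mul_assoc, hI, one_mul]
  exact (riemannZetaNontrivialZeros_countable.image _).mono hsub

/-- `ξ` is entire and not identically zero, so its order of vanishing is finite everywhere.
[folklore] -/
private theorem analyticOrderAt_riemannXi_ne_top' (s : ℂ) : analyticOrderAt riemannXi s ≠ ⊤ := by
  intro htop
  have h0 : riemannXi 0 = 0 :=
    AnalyticOnNhd.eqOn_zero_of_preconnected_of_eventuallyEq_zero (f := riemannXi) (U := Set.univ)
      (fun z _ ↦ differentiable_riemannXi.analyticAt z) isPreconnected_univ (Set.mem_univ s)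
      (analyticOrderAt_eq_top.mp htop) (Set.mem_univ 0)
  rw [riemannXi_zero] at h0
  norm_num at h0

/-- The order of vanishing of `Ξ` at `z` equals that of `ξ` at `½ + iz` (affine change of
variable). [folklore] -/
private theorem analyticOrderNatAt_xiUpper_eq (z : ℂ) :
    analyticOrderNatAt riemannXiUpper z = analyticOrderNatAt riemannXi ((1 : ℂ) / 2 + I * z) := by
  have hcomp : riemannXiUpper = riemannXi ∘ fun w : ℂ ↦ (1 : ℂ) / 2 + I * w := rfl
  have hd : HasDerivAt (fun w : ℂ ↦ (1 : ℂ) / 2 + I * w) I z := by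
    simpa using ((hasDerivAt_id z).const_mul I).const_add ((1 : ℂ) / 2)
  have h := analyticOrderAt_comp_of_deriv_ne_zero (f := riemannXi)
    (g := fun w : ℂ ↦ (1 : ℂ) / 2 + I * w) (z₀ := z) (by fun_prop) (by rw [hd.deriv]; exact I_ne_zero)
  unfold analyticOrderNatAt
  rw [hcomp, h]

/-- **Multiplicities agree**: the order of `z` as a zero of `Ξ` is the tree's multiplicity
`m(½ + iz) = riemannZetaZeroOrder (½ + iz)` of the corresponding zero of `ζ` (CR: "`ρ_k` is a root
of order `m_k`"). [cite: CardonRoberts2006, §1 p. 55] -/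
theorem natCast_analyticOrderNatAt_eq {z : ℂ} (hz : z ∈ cardonRobertsZeros) :
    ((analyticOrderNatAt riemannXiUpper z : ℕ) : ℤ) = riemannZetaZeroOrder ((1 : ℂ) / 2 + I * z) := by
  have hmem := half_add_mem_nontrivialZeros hz
  rw [analyticOrderNatAt_xiUpper_eq]
  rw [← untop₀_meromorphicOrderAt_riemannXi
    (ZetaZeros.riemannZetaNontrivialZeros.re_pos hmem)
    (ZetaZeros.riemannZetaNontrivialZeros.ne_one hmem),
    (differentiable_riemannXi.analyticAt ((1 : ℂ) / 2 + I * z)).meromorphicOrderAt_eq,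
    ← Nat.cast_analyticOrderNatAt (analyticOrderAt_riemannXi_ne_top' ((1 : ℂ) / 2 + I * z))]
  simp

/-- Multiplicities are `≥ 1`. [cite: CardonRoberts2006, §1 p. 55] -/
theorem one_le_analyticOrderNatAt {z : ℂ} (hz : z ∈ cardonRobertsZeros) :
    1 ≤ analyticOrderNatAt riemannXiUpper z := by
  have h1 := ZetaZeros.riemannZetaNontrivialZeros.one_le_order (half_add_mem_nontrivialZeros hz)
  rw [← natCast_analyticOrderNatAt_eq hz] at h1
  exact_mod_cast h1

/-- The map `z ↦ ½ + iz` from the zeros of `Ξ` with `Re z > 0` to the non-trivial zeros of `ζ`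
is injective ("`ρ_k = ½ + i(α_k + iβ_k)`"). [cite: CardonRoberts2006, §1 p. 55] -/
theorem toZeta_injective : Function.Injective fun z : cardonRobertsZeros ↦
    (⟨(1 : ℂ) / 2 + I * z, half_add_mem_nontrivialZeros z.2⟩ : RHWave0.riemannZetaNontrivialZeros) := by
  intro z w h
  have h' : (1 : ℂ) / 2 + I * (z : ℂ) = 1 / 2 + I * (w : ℂ) := congrArg Subtype.val h
  exact Subtype.ext (mul_left_cancel₀ I_ne_zero (add_left_cancel h'))

/-- `|½ + iz|² ≤ 2 (Re z)²` for a zero `z` of `Ξ` with `Re z > 0` (`0 < Re(½+iz) < 1`,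
`Re z > 14`). [cite: CardonRoberts2006, §1 p. 55] -/
theorem norm_sq_half_add_le {z : ℂ} (hz : z ∈ cardonRobertsZeros) :
    ‖(1 : ℂ) / 2 + I * z‖ ^ 2 ≤ 2 * z.re ^ 2 := by
  have h := (riemannXi_eq_zero_iff_holds ((1 : ℂ) / 2 + I * z)).1 hz.1
  have h14 := fourteen_lt_re hz
  rw [re_half_add] at h
  rw [Complex.sq_norm, Complex.normSq_apply, re_half_add, im_half_add]
  nlinarith [h.2.1, h.2.2]

/-! ### The spectrum `S = {Re z} ⊂ (14, ∞)`: infinite, locally finite, `Σ a⁻² < ∞` -/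

/-- Every point of the spectrum exceeds `14`. [cite: CardonRoberts2006, §3 p. 61] -/
theorem fourteen_lt_of_mem_spectrum {a : ℝ} (ha : a ∈ cardonRobertsSpectrum) : 14 < a := by
  obtain ⟨z, hz, rfl⟩ := ha
  exact fourteen_lt_re hz

/-- A real `t > 0` with `ζ(½ + it) = 0` is (as a real zero of `Ξ`) in `cardonRobertsZeros`.
[cite: CardonRoberts2006, §1 p. 55] -/
theorem ofReal_mem_zeros {t : ℝ} (ht : 0 < t) (hζ : riemannZeta (1 / 2 + t * I) = 0) :
    (t : ℂ) ∈ cardonRobertsZeros := by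
  refine ⟨?_, by simpa using ht⟩
  show riemannXi (1 / 2 + I * (t : ℂ)) = 0
  rw [mul_comm]
  refine (riemannXi_eq_zero_iff_holds _).2 ⟨hζ, ?_, ?_⟩
  · simp
  · simp; norm_num

/-- **The spectrum is infinite** (Hardy: infinitely many zeros on the critical line; a critical
zero `½ + it` gives `|t| ∈ S`, using `Ξ(−t) = Ξ(t)`). [cite: CardonRoberts2006, §3 p. 61] -/
theorem spectrum_infinite : cardonRobertsSpectrum.Infinite := by
  intro hfin
  have hH := hardy_infinite_zeros_on_critical_line_holds
  apply hH
  refine (hfin.union (hfin.image fun a : ℝ ↦ -a)).subset fun t ht ↦ ?_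
  have hζ : riemannZeta (1 / 2 + t * I) = 0 := ht
  have ht0 : t ≠ 0 := by
    intro h0
    rw [h0] at hζ
    have hmem : ((1 : ℂ) / 2 + (0 : ℝ) * I) ∈ RHWave0.riemannZetaNontrivialZeros :=
      ZetaZeros.riemannZetaNontrivialZeros.mem_of_re_pos hζ (by simp)
    have h14 := FordL33.fourteen_lt_abs_im ⟨_, hmem⟩
    simp at h14
    linarith
  rcases lt_or_gt_of_ne ht0 with hneg | hpos
  · right
    refine ⟨-t, ⟨((-t : ℝ) : ℂ), ⟨?_, by simp; linarith⟩, by simp⟩, by ring⟩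
    have h1 : riemannXiUpper (t : ℂ) = 0 := by
      show riemannXi (1 / 2 + I * (t : ℂ)) = 0
      rw [mul_comm]
      have hre := re_mem_Ioo_of_riemannZeta_eq_zero_of_im_ne_zero hζ (by simp [ht0])
      exact (riemannXi_eq_zero_iff_holds _).2 ⟨hζ, by simpa using hre⟩
    rw [show ((-t : ℝ) : ℂ) = -(t : ℂ) by push_cast; ring, riemannXiUpper_neg]
    exact h1
  · left
    exact ⟨(t : ℂ), ofReal_mem_zeros hpos hζ, by simp⟩

/-- **The spectrum is locally finite**: `S ∩ (−∞, L]` is finite (the ordinates in `(0, L]` of zeros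
of `ζ` are finitely many, `zetaZeroBox_finite`). [cite: CardonRoberts2006, §3 p. 61] -/
theorem spectrum_inter_Iic_finite (L : ℝ) : (cardonRobertsSpectrum ∩ Set.Iic L).Finite := by
  refine ((zetaZeroBox_finite 0 L).image Complex.im).subset ?_
  rintro a ⟨⟨z, hz, rfl⟩, haL⟩
  have h := (riemannXi_eq_zero_iff_holds ((1 : ℂ) / 2 + I * z)).1 hz.1
  refine ⟨(1 : ℂ) / 2 + I * z, ⟨h.1, h.2.1.le, h.2.2.le, ?_, ?_⟩, im_half_add z⟩
  · rw [im_half_add]; exact hz.2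
  · rw [im_half_add]; exact haL

/-- **`Σ_{a ∈ S} a⁻² < ∞`** (from `Σ_ρ m(ρ)/|ρ|² < ∞` over the non-trivial zeros and
`|½ + iz|² ≤ 2 (Re z)²`). [cite: CardonRoberts2006, Lemma 3.5 p. 62 (`Σ 1/a_k²` converges)] -/
theorem summable_spectrum_inv_sq :
    Summable fun a : cardonRobertsSpectrum ↦ ((a : ℝ) ^ 2)⁻¹ := by
  classical
  -- choose a zero above each point of the spectrum
  have hch : ∀ a : cardonRobertsSpectrum, ∃ z : cardonRobertsZeros, ((z : ℂ)).re = a :=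
    fun a ↦ by obtain ⟨z, hz, hza⟩ := a.2; exact ⟨⟨z, hz⟩, hza⟩
  choose zf hzf using hch
  set ψ : cardonRobertsSpectrum → RHWave0.riemannZetaNontrivialZeros :=
    fun a ↦ ⟨(1 : ℂ) / 2 + I * (zf a : ℂ), half_add_mem_nontrivialZeros (zf a).2⟩ with hψ
  have hinj : Function.Injective ψ := by
    intro a b h
    have h1 := congrArg (fun s : RHWave0.riemannZetaNontrivialZeros ↦ (s : ℂ).im) h
    simp only [hψ, im_half_add, hzf] at h1
    exact Subtype.ext h1
  have hS := (FordL33.summable_order_div_norm_sq.mul_left 2).comp_injective hinj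
  refine hS.of_nonneg_of_le (fun a ↦ by positivity) fun a ↦ ?_
  simp only [Function.comp_apply]
  have h14 : 14 < (a : ℝ) := fourteen_lt_of_mem_spectrum a.2
  have hm : (1 : ℝ) ≤ riemannZetaZeroOrder (ψ a : ℂ) := by
    exact_mod_cast ZetaZeros.riemannZetaNontrivialZeros.one_le_order (ψ a).2
  have hn : ‖(ψ a : ℂ)‖ ^ 2 ≤ 2 * (a : ℝ) ^ 2 := by
    have := norm_sq_half_add_le (zf a).2
    rw [hzf] at this
    exact this
  have hn0 : 0 < ‖(ψ a : ℂ)‖ ^ 2 := by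
    have := FordL33.fourteen_lt_norm (ψ a); positivity
  rw [inv_le_iff_one_le_mul₀ (by positivity)]
  calc (1 : ℝ) ≤ 2 * (1 / 2) := by norm_num
    _ ≤ 2 * ((riemannZetaZeroOrder (ψ a : ℂ) : ℝ) / ‖(ψ a : ℂ)‖ ^ 2 * (a : ℝ) ^ 2) := by
        gcongr
        rw [div_mul_eq_mul_div, le_div_iff₀ hn0]
        nlinarith
    _ = 2 * ((riemannZetaZeroOrder (ψ a : ℂ) : ℝ) / ‖(ψ a : ℂ)‖ ^ 2) * (a : ℝ) ^ 2 := by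
        ring

/-! ### The master summability over the zeros -/

/-- `x^n e^{−bx} ≤ n!/b^n` for `x ≥ 0`, `b > 0`. [folklore] -/
private theorem pow_mul_exp_neg_le {x b : ℝ} (hx : 0 ≤ x) (hb : 0 < b) (n : ℕ) :
    x ^ n * Real.exp (-(b * x)) ≤ n.factorial / b ^ n := by
  have h := Real.pow_div_factorial_le_exp (b * x) (by positivity) n
  rw [mul_pow, div_le_iff₀ (by positivity)] at h
  rw [le_div_iff₀ (by positivity), Real.exp_neg]
  have hexp : 0 < Real.exp (b * x) := Real.exp_pos _
  calc x ^ n * (Real.exp (b * x))⁻¹ * b ^ n = (b ^ n * x ^ n) / Real.exp (b * x) := by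
        rw [div_eq_mul_inv]; ring
    _ ≤ n.factorial := by rw [div_le_iff₀ hexp]; linarith

/-- **Master bound.** For an admissible `f` with `|f(z)| < e^{−c Re z}` on the strip, the series
`Σ_z m(z) Re f(z) · (Re z)^j e^{(c/2) Re z}` over the zeros of `Ξ` with `Re z > 0` converges (the
terms are `≤ (j+2)! (2/c)^{j+2} · 2 m(z)/|½+iz|²`). This is the only global input from `ζ`: the
convergence of `Σ_ρ m(ρ)/|ρ|²`. [cite: CardonRoberts2006, Lemma 2.3 p. 57 and (3) p. 55] -/
theorem summable_weight_pow_exp {f : ℂ → ℂ} (hf : IsCardonRobertsWeight f) {c : ℝ} (hc : 0 < c)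
    (hcf : ∀ z ∈ cardonRobertsStrip, ‖f z‖ < Real.exp (-(c * z.re))) (j : ℕ) :
    Summable fun z : cardonRobertsZeros ↦
      (analyticOrderNatAt riemannXiUpper (z : ℂ) : ℝ) * (f z).re *
        ((z : ℂ).re ^ j * Real.exp (c / 2 * (z : ℂ).re)) := by
  set B : ℝ := (j + 2).factorial / (c / 2) ^ (j + 2) with hB
  have hS := (FordL33.summable_order_div_norm_sq.mul_left (2 * B)).comp_injective toZeta_injective
  refine hS.of_nonneg_of_le (fun z ↦ ?_) fun z ↦ ?_
  · have h1 := (hf.re_pos z (mem_strip z.2)).le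
    have h2 := (fourteen_lt_re z.2).le
    positivity
  · simp only [Function.comp_apply]
    have hz := z.2
    have ha : 0 < (z : ℂ).re := hz.2
    set a : ℝ := (z : ℂ).re with ha_def
    set s : RHWave0.riemannZetaNontrivialZeros :=
      ⟨(1 : ℂ) / 2 + I * z, half_add_mem_nontrivialZeros hz⟩ with hs
    have hm0 : (0 : ℝ) ≤ analyticOrderNatAt riemannXiUpper (z : ℂ) := by positivity
    have hmeq : (analyticOrderNatAt riemannXiUpper (z : ℂ) : ℝ) =
        (riemannZetaZeroOrder (s : ℂ) : ℝ) := by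
      have := natCast_analyticOrderNatAt_eq hz
      exact_mod_cast this
    -- `Re f ≤ |f| < e^{-c a}`
    have hfre : (f z).re ≤ Real.exp (-(c * a)) :=
      ((Complex.re_le_norm _).trans (hcf z (mem_strip hz)).le)
    have hfre0 : 0 ≤ (f z).re := (hf.re_pos z (mem_strip hz)).le
    -- `a^{j+2} e^{-(c/2) a} ≤ B`
    have hpow : a ^ (j + 2) * Real.exp (-(c / 2 * a)) ≤ B := pow_mul_exp_neg_le ha.le (by positivity) _
    have hn : ‖(s : ℂ)‖ ^ 2 ≤ 2 * a ^ 2 := norm_sq_half_add_le hz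
    have hn0 : 0 < ‖(s : ℂ)‖ ^ 2 := by
      have := FordL33.fourteen_lt_norm s; positivity
    have hmz : (0 : ℝ) ≤ riemannZetaZeroOrder (s : ℂ) := (FordL33.order_pos _).le
    -- combine
    have hexp_split : Real.exp (-(c * a)) * Real.exp (c / 2 * a) = Real.exp (-(c / 2 * a)) := by
      rw [← Real.exp_add]; congr 1; ring
    have hnz : ‖(s : ℂ)‖ ≠ 0 := by
      have := FordL33.fourteen_lt_norm s; positivity
    have ha0 : a ≠ 0 := ha.ne'
    calc (analyticOrderNatAt riemannXiUpper (z : ℂ) : ℝ) * (f z).re * (a ^ j * Real.exp (c / 2 * a))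
        ≤ (analyticOrderNatAt riemannXiUpper (z : ℂ) : ℝ) * Real.exp (-(c * a)) *
            (a ^ j * Real.exp (c / 2 * a)) := by gcongr
      _ = (analyticOrderNatAt riemannXiUpper (z : ℂ) : ℝ) * (a ^ j * Real.exp (-(c / 2 * a))) := by
          rw [← hexp_split]; ring
      _ = (riemannZetaZeroOrder (s : ℂ) : ℝ) / ‖(s : ℂ)‖ ^ 2 *
            (‖(s : ℂ)‖ ^ 2 / a ^ 2 * (a ^ (j + 2) * Real.exp (-(c / 2 * a)))) := by
          rw [hmeq]; field_simp; ring
      _ ≤ (riemannZetaZeroOrder (s : ℂ) : ℝ) / ‖(s : ℂ)‖ ^ 2 * (2 * B) := by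
          refine mul_le_mul_of_nonneg_left ?_ (by positivity)
          refine mul_le_mul ?_ hpow (by positivity) (by norm_num)
          rw [div_le_iff₀ (by positivity)]; linarith
      _ = 2 * B * ((riemannZetaZeroOrder (s : ℂ) : ℝ) / ‖(s : ℂ)‖ ^ 2) := by ring

/-! ## §2 Symmetric countable sums of point masses: integrals as `tsum`s, the abstract hypotheses

Everything in this section is about a measure of the shape
`μ = Σ_k w_k (δ_{a_k} + δ_{−a_k})` over a countable index type (the shape of `dF`,
`cardonRobertsMeasure`): its integrals are `tsum`s over `κ ⊕ κ`, and the hypotheses `hmom`, `hae`,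
`hsym`, `hgap`, `hS` of layers A–B2 hold as soon as `w_k > 0`, `a_k ≥ δ₀ > 0`, the `a_k` are
infinitely many and `Σ w_k a_k^j e^{δ a_k} < ∞`. -/

section PointMasses

variable {κ : Type*} {μ : Measure ℝ} {w : κ → ℝ} {a : κ → ℝ}

/-- The two-sided family of point masses as a single family over `κ ⊕ κ`.
[cite: CardonRoberts2006, (8) p. 56 (the measure `dF`)] -/
theorem sum_pair_eq_sum_dirac (c : κ → ENNReal) (a : κ → ℝ) :
    Measure.sum (fun k ↦ c k • (Measure.dirac (a k) + Measure.dirac (-a k))) =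
      Measure.sum (fun i : κ ⊕ κ ↦
        Sum.elim c c i • Measure.dirac (Sum.elim a (fun k ↦ -a k) i)) := by
  ext s hs
  simp only [Measure.sum_apply _ hs, Measure.smul_apply, Measure.coe_add, Pi.add_apply,
    smul_eq_mul, mul_add]
  rw [ENNReal.tsum_add, Summable.tsum_sum ENNReal.summable ENNReal.summable]
  simp

/-- **Integrals against `Σ_k w_k(δ_{a_k} + δ_{−a_k})` are `tsum`s**:
`∫ g dμ = Σ_{i ∈ κ ⊕ κ} w_i g(±a_i)` (unconditionally, with the `tsum` convention).
[cite: CardonRoberts2006, (8)–(9) p. 56] -/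
theorem integral_eq_tsum [Countable κ] (hμ : μ = Measure.sum fun k ↦
      ENNReal.ofReal (w k) • (Measure.dirac (a k) + Measure.dirac (-a k)))
    (hw0 : ∀ k, 0 ≤ w k) (g : ℝ → ℝ) :
    ∫ x, g x ∂μ = ∑' i : κ ⊕ κ, Sum.elim w w i * g (Sum.elim a (fun k ↦ -a k) i) := by
  rw [hμ, sum_pair_eq_sum_dirac, integral_sum_dirac (fun i ↦ ?_)]
  · refine tsum_congr fun i ↦ ?_
    cases i <;> simp [ENNReal.toReal_ofReal (hw0 _)]
  · cases i <;> simp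

/-- Integrability against `Σ_k w_k(δ_{a_k} + δ_{−a_k})` is summability of `w_i |g(±a_i)|`.
[cite: CardonRoberts2006, (8)–(9) p. 56] -/
theorem integrable_iff_summable [Countable κ] (hμ : μ = Measure.sum fun k ↦
      ENNReal.ofReal (w k) • (Measure.dirac (a k) + Measure.dirac (-a k)))
    (hw0 : ∀ k, 0 ≤ w k) (g : ℝ → ℝ) :
    Integrable g μ ↔
      Summable fun i : κ ⊕ κ ↦ Sum.elim w w i * |g (Sum.elim a (fun k ↦ -a k) i)| := by
  rw [hμ, sum_pair_eq_sum_dirac, integrable_sum_dirac_iff (fun i ↦ ?_)]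
  · refine summable_congr fun i ↦ ?_
    cases i <;> simp [ENNReal.toReal_ofReal (hw0 _)]
  · cases i <;> simp

/-- A property holding at all the atoms `±a_k` holds `μ`-a.e. [cite: CardonRoberts2006, (8)–(9) p. 56] -/
theorem ae_of_forall_atoms [Countable κ] (hμ : μ = Measure.sum fun k ↦
      ENNReal.ofReal (w k) • (Measure.dirac (a k) + Measure.dirac (-a k)))
    {p : ℝ → Prop} (h : ∀ k, p (a k) ∧ p (-a k)) : ∀ᵐ x ∂μ, p x := by
  rw [hμ, Measure.ae_sum_iff]
  intro k
  refine Measure.ae_smul_measure ((ae_add_measure_iff).2 ⟨?_, ?_⟩) _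
  · rw [ae_dirac_eq, Filter.eventually_pure]; exact (h k).1
  · rw [ae_dirac_eq, Filter.eventually_pure]; exact (h k).2

/-- Conversely a `μ`-a.e. property holds at every atom of positive mass.
[cite: CardonRoberts2006, (8)–(9) p. 56] -/
theorem forall_atoms_of_ae [Countable κ] (hμ : μ = Measure.sum fun k ↦
      ENNReal.ofReal (w k) • (Measure.dirac (a k) + Measure.dirac (-a k)))
    (hw : ∀ k, 0 < w k) {p : ℝ → Prop} (h : ∀ᵐ x ∂μ, p x) (k : κ) : p (a k) ∧ p (-a k) := by
  rw [hμ, Measure.ae_sum_iff] at h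
  have hk := h k
  have hc : ENNReal.ofReal (w k) ≠ 0 := by
    rw [Ne, ENNReal.ofReal_eq_zero, not_le]; exact hw k
  have hk' : ∀ᵐ x ∂(Measure.dirac (a k) + Measure.dirac (-a k)), p x := by
    rw [ae_iff] at hk ⊢
    rw [Measure.smul_apply, smul_eq_mul, mul_eq_zero] at hk
    exact hk.resolve_left hc
  rw [ae_add_measure_iff, ae_dirac_eq, ae_dirac_eq, Filter.eventually_pure,
    Filter.eventually_pure] at hk'
  exact hk'

/-- The swap `inl ↔ inr` reverses the sign of the atom and preserves the weight:
`Σ_i w_i g(−A_i) = Σ_i w_i g(A_i)`. [cite: CardonRoberts2006, Lemma 3.1 p. 58 (symmetry of `dF`)] -/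
theorem tsum_neg_atoms (w : κ → ℝ) (a : κ → ℝ) (g : ℝ → ℝ) :
    ∑' i : κ ⊕ κ, Sum.elim w w i * g (-Sum.elim a (fun k ↦ -a k) i) =
      ∑' i : κ ⊕ κ, Sum.elim w w i * g (Sum.elim a (fun k ↦ -a k) i) := by
  rw [← (Equiv.sumComm κ κ).tsum_eq (fun i : κ ⊕ κ ↦ Sum.elim w w i * g (Sum.elim a (fun k ↦ -a k) i))]
  refine tsum_congr fun i ↦ ?_
  cases i <;> simp

/-- Weighted moments `Σ_i w_i |A_i|^j` over `κ ⊕ κ` converge under the exponential-moment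
hypothesis. [cite: CardonRoberts2006, Lemma 2.3 p. 57] -/
theorem summable_weight_abs_pow (hw0 : ∀ k, 0 ≤ w k) (ha0 : ∀ k, 0 ≤ a k) {δ : ℝ} (hδ : 0 ≤ δ)
    (hexp : ∀ j : ℕ, Summable fun k ↦ w k * (a k ^ j * Real.exp (δ * a k))) (j : ℕ) :
    Summable fun i : κ ⊕ κ ↦ Sum.elim w w i * |Sum.elim a (fun k ↦ -a k) i| ^ j := by
  have hhalf : Summable fun k ↦ w k * a k ^ j := by
    refine (hexp j).of_nonneg_of_le (fun k ↦ mul_nonneg (hw0 k) (pow_nonneg (ha0 k) _)) fun k ↦ ?_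
    refine mul_le_mul_of_nonneg_left ?_ (hw0 k)
    have : 1 ≤ Real.exp (δ * a k) := Real.one_le_exp (mul_nonneg hδ (ha0 k))
    nlinarith [pow_nonneg (ha0 k) j]
  refine Summable.sum _ ?_ ?_
  · simpa [Function.comp_def, abs_of_nonneg (ha0 _)] using hhalf
  · simpa [Function.comp_def, abs_of_nonneg (ha0 _)] using hhalf

/-- `|q(x)| ≤ Σ_{k ≤ deg q} |q_k| |x|^k`. [folklore] -/
private theorem abs_eval_le (q : ℝ[X]) (x : ℝ) :
    |q.eval x| ≤ ∑ k ∈ Finset.range (q.natDegree + 1), |q.coeff k| * |x| ^ k := by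
  rw [Polynomial.eval_eq_sum_range]
  refine (Finset.abs_sum_le_sum_abs _ _).trans (le_of_eq (Finset.sum_congr rfl fun k _ ↦ ?_))
  rw [abs_mul, abs_pow]

/-- `Σ_i w_i |q(A_i)|` converges for every polynomial `q`. [cite: CardonRoberts2006, Lemma 2.3 p. 57] -/
theorem summable_weight_abs_eval (hw0 : ∀ k, 0 ≤ w k) (ha0 : ∀ k, 0 ≤ a k) {δ : ℝ} (hδ : 0 ≤ δ)
    (hexp : ∀ j : ℕ, Summable fun k ↦ w k * (a k ^ j * Real.exp (δ * a k))) (q : ℝ[X]) :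
    Summable fun i : κ ⊕ κ ↦ Sum.elim w w i * |q.eval (Sum.elim a (fun k ↦ -a k) i)| := by
  have hW0 : ∀ i : κ ⊕ κ, 0 ≤ Sum.elim w w i := fun i ↦ by cases i <;> simp [hw0]
  refine (summable_sum (s := Finset.range (q.natDegree + 1)) fun k _ ↦
    (summable_weight_abs_pow hw0 ha0 hδ hexp k).mul_left |q.coeff k|).of_nonneg_of_le
    (fun i ↦ mul_nonneg (hW0 i) (abs_nonneg _)) fun i ↦ ?_
  calc Sum.elim w w i * |q.eval (Sum.elim a (fun k ↦ -a k) i)|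
      ≤ Sum.elim w w i * ∑ k ∈ Finset.range (q.natDegree + 1),
          |q.coeff k| * |Sum.elim a (fun k ↦ -a k) i| ^ k :=
        mul_le_mul_of_nonneg_left (abs_eval_le q _) (hW0 i)
    _ = ∑ k ∈ Finset.range (q.natDegree + 1),
          |q.coeff k| * (Sum.elim w w i * |Sum.elim a (fun k ↦ -a k) i| ^ k) := by
        rw [Finset.mul_sum]
        refine Finset.sum_congr rfl fun k _ ↦ ?_
        ring

/-- **`hmom`**: all moments of `μ` exist. [cite: CardonRoberts2006, Lemma 2.3 p. 57] -/
theorem integrable_pow [Countable κ] (hμ : μ = Measure.sum fun k ↦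
      ENNReal.ofReal (w k) • (Measure.dirac (a k) + Measure.dirac (-a k)))
    (hw0 : ∀ k, 0 ≤ w k) (ha0 : ∀ k, 0 ≤ a k) {δ : ℝ} (hδ : 0 ≤ δ)
    (hexp : ∀ j : ℕ, Summable fun k ↦ w k * (a k ^ j * Real.exp (δ * a k))) (m : ℕ) :
    Integrable (fun x : ℝ ↦ x ^ m) μ := by
  rw [integrable_iff_summable hμ hw0]
  simpa [abs_pow] using summable_weight_abs_pow hw0 ha0 hδ hexp m

/-- **`hae`**: a polynomial vanishing `μ`-a.e. vanishes at the infinitely many atoms, hence is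
`0`. [cite: CardonRoberts2006, Lemma 3.1 p. 58 (infinite support)] -/
theorem eq_zero_of_eval_ae_eq_zero [Countable κ] (hμ : μ = Measure.sum fun k ↦
      ENNReal.ofReal (w k) • (Measure.dirac (a k) + Measure.dirac (-a k)))
    (hw : ∀ k, 0 < w k) (hinf : (Set.range a).Infinite) (p : ℝ[X])
    (h : (fun x : ℝ ↦ p.eval x) =ᵐ[μ] 0) : p = 0 := by
  refine Polynomial.eq_zero_of_infinite_isRoot p (hinf.mono ?_)
  rintro _ ⟨k, rfl⟩
  exact (forall_atoms_of_ae hμ hw h k).1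

/-- **`hsym`**: `μ` is even on polynomials. [cite: CardonRoberts2006, Lemma 3.1 p. 58] -/
theorem integral_eval_neg [Countable κ] (hμ : μ = Measure.sum fun k ↦
      ENNReal.ofReal (w k) • (Measure.dirac (a k) + Measure.dirac (-a k)))
    (hw0 : ∀ k, 0 ≤ w k) (p : ℝ[X]) :
    ∫ x, p.eval (-x) ∂μ = ∫ x, p.eval x ∂μ := by
  rw [integral_eq_tsum hμ hw0 (fun x ↦ p.eval (-x)), integral_eq_tsum hμ hw0 (fun x ↦ p.eval x)]
  exact tsum_neg_atoms w a fun x ↦ p.eval x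

/-- **`hgap`**: `μ` puts no mass within `δ₀` of the origin. [cite: CardonRoberts2006, §3 p. 61 (`a_1 > 0`)] -/
theorem ae_le_abs [Countable κ] (hμ : μ = Measure.sum fun k ↦
      ENNReal.ofReal (w k) • (Measure.dirac (a k) + Measure.dirac (-a k)))
    {δ₀ : ℝ} (hge : ∀ k, δ₀ ≤ a k) : ∀ᵐ x ∂μ, δ₀ ≤ |x| :=
  ae_of_forall_atoms hμ fun k ↦
    ⟨(hge k).trans (le_abs_self _), (hge k).trans (by rw [abs_neg]; exact le_abs_self _)⟩

/-- **`hS`**: `μ` is carried by `{y : |y| ∈ range a}`. [cite: CardonRoberts2006, §3 p. 61] -/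
theorem ae_abs_mem_range [Countable κ] (hμ : μ = Measure.sum fun k ↦
      ENNReal.ofReal (w k) • (Measure.dirac (a k) + Measure.dirac (-a k)))
    (ha0 : ∀ k, 0 ≤ a k) : ∀ᵐ y ∂μ, |y| ∈ Set.range a :=
  ae_of_forall_atoms hμ fun k ↦
    ⟨⟨k, (abs_of_nonneg (ha0 k)).symm⟩, ⟨k, by rw [abs_neg, abs_of_nonneg (ha0 k)]⟩⟩

end PointMasses

/-! ## §3 `P_{2n}(a_k) → 0` and the odd analogue (the tree's replacement of CR Lemma 3.4)

For `μ = Σ_k w_k(δ_{a_k} + δ_{−a_k})` as in §2: the normalised even polynomial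
`P_{2n}(x) = p_{2n}(x)/p_{2n}(0)` satisfies `w_k (P_{2n}(a_k)/a_k)² ≤ ∫ (P_{2n}(x)/x)² dμ ≤
∫ ((1 − x²T(x))/x)² dμ = Σ_i w_i A_i² (A_i⁻² − T(A_i))²` for every `T` of degree `< 2n`
(layer B2), and by polynomial density (layer C, weights `w_i A_i²`) the right side can be made
`< ε`; so `P_{2n}(a_k) → 0`. The odd case uses `∫ (p_{2n+1}(x)/(x p'_{2n+1}(0)))² ≤ ∫ (1 − x²T)²`
and the weights `w_i A_i⁴`. -/

section Vanishing

variable {κ : Type*} [Countable κ] {μ : Measure ℝ} {w : κ → ℝ} {a : κ → ℝ}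

/-- A single atom's contribution is below the integral of a non-negative function.
[cite: CardonRoberts2006, (9) p. 56] -/
theorem weight_mul_le_integral (hμ : μ = Measure.sum fun k ↦
      ENNReal.ofReal (w k) • (Measure.dirac (a k) + Measure.dirac (-a k)))
    (hw0 : ∀ k, 0 ≤ w k) (g : ℝ → ℝ) (hg : ∀ x, 0 ≤ g x)
    (hsum : Summable fun i : κ ⊕ κ ↦ Sum.elim w w i * |g (Sum.elim a (fun k ↦ -a k) i)|)
    (k : κ) : w k * g (a k) ≤ ∫ x, g x ∂μ := by
  rw [integral_eq_tsum hμ hw0 g]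
  have hsum' : Summable fun i : κ ⊕ κ ↦ Sum.elim w w i * g (Sum.elim a (fun k ↦ -a k) i) :=
    (summable_congr fun i ↦ by rw [abs_of_nonneg (hg _)]).1 hsum
  have hW0 : ∀ i : κ ⊕ κ, 0 ≤ Sum.elim w w i := fun i ↦ by cases i <;> simp [hw0]
  have h := hsum'.le_tsum (Sum.inl k) (fun j _ ↦ mul_nonneg (hW0 j) (hg _))
  simpa using h

/-- **`P_{2n}(a_k) → 0` for every atom `a_k`** (even case).
[cite: CardonRoberts2006, Lemma 3.4 pp. 61–62 (tree's substitute road: extremality + density)] -/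
theorem tendsto_even_ratio (hμ : μ = Measure.sum fun k ↦
      ENNReal.ofReal (w k) • (Measure.dirac (a k) + Measure.dirac (-a k)))
    (hw : ∀ k, 0 < w k) {δ₀ : ℝ} (hδ₀ : 0 < δ₀) (hge : ∀ k, δ₀ ≤ a k) {δ : ℝ} (hδ : 0 < δ)
    (hexp : ∀ j : ℕ, Summable fun k ↦ w k * (a k ^ j * Real.exp (δ * a k)))
    (hinf : (Set.range a).Infinite) (k₀ : κ) :
    Tendsto (fun n ↦ (cardonRobertsPoly μ (2 * n)).eval (a k₀) /
      (cardonRobertsPoly μ (2 * n)).eval 0) atTop (𝓝 0) := by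
  have hw0 : ∀ k, 0 ≤ w k := fun k ↦ (hw k).le
  have ha0 : ∀ k, 0 ≤ a k := fun k ↦ hδ₀.le.trans (hge k)
  have hapos : ∀ k, 0 < a k := fun k ↦ hδ₀.trans_le (hge k)
  have hmom := integrable_pow hμ hw0 ha0 hδ.le hexp
  have hae := eq_zero_of_eval_ae_eq_zero hμ hw hinf
  have hsym := integral_eval_neg hμ hw0
  have hgap := ae_le_abs hμ hge
  -- the `⊕`-indexed atoms and weights
  set A : κ ⊕ κ → ℝ := Sum.elim a (fun k ↦ -a k) with hA
  set W : κ ⊕ κ → ℝ := Sum.elim w w with hW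
  have hA_abs : ∀ i, |A i| = a (Sum.elim id id i) := by
    intro i; cases i <;> simp [hA, abs_of_nonneg (ha0 _)]
  have hA_sq : ∀ i, A i ^ 2 = a (Sum.elim id id i) ^ 2 := by intro i; cases i <;> simp [hA]
  have hA_ne : ∀ i, A i ≠ 0 := by intro i; cases i <;> simp [hA, (hapos _).ne']
  have hA_ge : ∀ i, δ₀ ≤ |A i| := fun i ↦ by rw [hA_abs]; exact hge _
  have hW_eq : ∀ i, W i = w (Sum.elim id id i) := by intro i; cases i <;> simp [hW]
  have hW0 : ∀ i, 0 ≤ W i := fun i ↦ by rw [hW_eq]; exact hw0 _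
  -- the density-theorem inputs for the weights `W i * A i²`
  have hexp2 : Summable fun i ↦ W i * A i ^ 2 * Real.exp (δ * |A i|) := by
    have h : ∀ i, W i * A i ^ 2 * Real.exp (δ * |A i|) =
        (fun k ↦ w k * (a k ^ 2 * Real.exp (δ * a k))) (Sum.elim id id i) := by
      intro i; rw [hW_eq, hA_sq, hA_abs]; simp only; ring
    rw [show (fun i ↦ W i * A i ^ 2 * Real.exp (δ * |A i|)) =
      fun i ↦ (fun k ↦ w k * (a k ^ 2 * Real.exp (δ * a k))) (Sum.elim id id i) from funext h]
    exact Summable.sum _ (by simpa [Function.comp_def] using hexp 2)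
      (by simpa [Function.comp_def] using hexp 2)
  have hsumW : Summable W := by
    have h := summable_weight_abs_pow hw0 ha0 hδ.le hexp 0
    simpa [hW] using h
  have hG : Summable fun i ↦ W i * A i ^ 2 * (1 / A i ^ 2) ^ 2 := by
    refine (hsumW.div_const (δ₀ ^ 2)).of_nonneg_of_le (fun i ↦ ?_) fun i ↦ ?_
    · have := hW0 i; positivity
    · have hAi : δ₀ ^ 2 ≤ A i ^ 2 := by
        rw [← sq_abs (A i)]; exact pow_le_pow_left₀ hδ₀.le (hA_ge i) 2
      have hAi0 : 0 < A i ^ 2 := lt_of_lt_of_le (pow_pos hδ₀ 2) hAi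
      have hAne : A i ≠ 0 := hA_ne i
      rw [show W i * A i ^ 2 * (1 / A i ^ 2) ^ 2 = W i / A i ^ 2 by field_simp]
      exact div_le_div_of_nonneg_left (hW0 i) (pow_pos hδ₀ 2) hAi
  rw [Metric.tendsto_atTop]
  intro ε hε
  have hε' : 0 < ε ^ 2 * w k₀ / a k₀ ^ 2 :=
    div_pos (mul_pos (pow_pos hε 2) (hw k₀)) (pow_pos (hapos k₀) 2)
  obtain ⟨T, -, hTlt⟩ := Literature.Analysis.Moments.exists_polynomial_approx A
    (fun i ↦ W i * A i ^ 2) (fun i ↦ mul_nonneg (hW0 i) (sq_nonneg _)) hδ hexp2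
    (fun x ↦ 1 / x ^ 2) hG hε'
  refine ⟨T.natDegree + 1, fun n hn ↦ ?_⟩
  have hT : T.degree < (2 * n : ℕ) :=
    lt_of_le_of_lt degree_le_natDegree (by exact_mod_cast (show T.natDegree < 2 * n by omega))
  have hB2 := CardonRobertsOP.integral_evenRatio_sq_le hmom hae hsym hδ₀ hgap n T hT
  set p := cardonRobertsPoly μ (2 * n) with hp
  obtain ⟨-, -, -, -, -, hp0, -⟩ := CardonRobertsOP.exists_evenRatio_eq_prod hmom hae hsym n
  -- the left side dominates the `k₀`-atom
  have hsumL : Summable fun i : κ ⊕ κ ↦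
      Sum.elim w w i * |(fun x : ℝ ↦ (p.eval x / (x * p.eval 0)) ^ 2) (Sum.elim a (fun k ↦ -a k) i)| := by
    have hq := summable_weight_abs_eval hw0 ha0 hδ.le hexp (p ^ 2)
    refine (hq.mul_left (1 / (δ₀ * p.eval 0) ^ 2)).of_nonneg_of_le
      (fun i ↦ mul_nonneg (hW0 i) (abs_nonneg _)) fun i ↦ ?_
    show W i * |(p.eval (A i) / (A i * p.eval 0)) ^ 2| ≤
      1 / (δ₀ * p.eval 0) ^ 2 * (W i * |(p ^ 2).eval (A i)|)
    rw [abs_of_nonneg (sq_nonneg _), eval_pow, abs_of_nonneg (sq_nonneg _), div_pow, mul_pow]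
    have h1 : (δ₀ * p.eval 0) ^ 2 ≤ A i ^ 2 * p.eval 0 ^ 2 := by
      rw [mul_pow, ← sq_abs (A i)]
      exact mul_le_mul_of_nonneg_right (pow_le_pow_left₀ hδ₀.le (hA_ge i) 2) (sq_nonneg _)
    have h2 : 0 < (δ₀ * p.eval 0) ^ 2 := by positivity
    rw [show 1 / (δ₀ * p.eval 0) ^ 2 * (W i * p.eval (A i) ^ 2) =
      W i * (p.eval (A i) ^ 2 / (δ₀ * p.eval 0) ^ 2) by ring]
    refine mul_le_mul_of_nonneg_left ?_ (hW0 i)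
    exact div_le_div_of_nonneg_left (sq_nonneg _) h2 h1
  have hleft := weight_mul_le_integral hμ hw0 (fun x : ℝ ↦ (p.eval x / (x * p.eval 0)) ^ 2)
    (fun x ↦ sq_nonneg _) hsumL k₀
  -- the right side is the density functional
  have hright : ∫ x, ((1 - x ^ 2 * T.eval x) / x) ^ 2 ∂μ =
      ∑' i, W i * A i ^ 2 * (1 / A i ^ 2 - T.eval (A i)) ^ 2 := by
    rw [integral_eq_tsum hμ hw0]
    refine tsum_congr fun i ↦ ?_
    have hAi : Sum.elim a (fun k ↦ -a k) i ≠ 0 := hA_ne i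
    simp only [hW, hA]
    field_simp
  -- combine
  have hchain : w k₀ * (p.eval (a k₀) / (a k₀ * p.eval 0)) ^ 2 < ε ^ 2 * w k₀ / a k₀ ^ 2 := by
    refine lt_of_le_of_lt (hleft.trans hB2) ?_
    rw [hright]
    exact hTlt
  have hwk := hw k₀
  have hak := hapos k₀
  have hp0' : p.eval 0 ≠ 0 := hp0
  have hsq : (p.eval (a k₀) / p.eval 0) ^ 2 < ε ^ 2 := by
    have h1 : w k₀ * (p.eval (a k₀) / (a k₀ * p.eval 0)) ^ 2 =
        (w k₀ / a k₀ ^ 2) * (p.eval (a k₀) / p.eval 0) ^ 2 := by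
      field_simp
    have h2 : ε ^ 2 * w k₀ / a k₀ ^ 2 = (w k₀ / a k₀ ^ 2) * ε ^ 2 := by ring
    rw [h1, h2] at hchain
    exact lt_of_mul_lt_mul_left hchain (div_pos hwk (pow_pos hak 2)).le
  rw [dist_zero_right, Real.norm_eq_abs]
  exact abs_lt_of_sq_lt_sq hsq hε.le

/-- **`p_{2n+1}(a_k)/(a_k p'_{2n+1}(0)) → 0` for every atom `a_k`** (odd case).
[cite: CardonRoberts2006, Lemma 3.4 pp. 61–62 (tree's substitute road: extremality + density)] -/
theorem tendsto_odd_ratio (hμ : μ = Measure.sum fun k ↦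
      ENNReal.ofReal (w k) • (Measure.dirac (a k) + Measure.dirac (-a k)))
    (hw : ∀ k, 0 < w k) {δ₀ : ℝ} (hδ₀ : 0 < δ₀) (hge : ∀ k, δ₀ ≤ a k) {δ : ℝ} (hδ : 0 < δ)
    (hexp : ∀ j : ℕ, Summable fun k ↦ w k * (a k ^ j * Real.exp (δ * a k)))
    (hinf : (Set.range a).Infinite) (k₀ : κ) :
    Tendsto (fun n ↦ (cardonRobertsPoly μ (2 * n + 1)).eval (a k₀) /
      (a k₀ * (derivative (cardonRobertsPoly μ (2 * n + 1))).eval 0)) atTop (𝓝 0) := by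
  have hw0 : ∀ k, 0 ≤ w k := fun k ↦ (hw k).le
  have ha0 : ∀ k, 0 ≤ a k := fun k ↦ hδ₀.le.trans (hge k)
  have hapos : ∀ k, 0 < a k := fun k ↦ hδ₀.trans_le (hge k)
  have hmom := integrable_pow hμ hw0 ha0 hδ.le hexp
  have hae := eq_zero_of_eval_ae_eq_zero hμ hw hinf
  have hsym := integral_eval_neg hμ hw0
  have hgap := ae_le_abs hμ hge
  set A : κ ⊕ κ → ℝ := Sum.elim a (fun k ↦ -a k) with hA
  set W : κ ⊕ κ → ℝ := Sum.elim w w with hW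
  have hA_abs : ∀ i, |A i| = a (Sum.elim id id i) := by
    intro i; cases i <;> simp [hA, abs_of_nonneg (ha0 _)]
  have hA_sq : ∀ i, A i ^ 2 = a (Sum.elim id id i) ^ 2 := by intro i; cases i <;> simp [hA]
  have hA_ne : ∀ i, A i ≠ 0 := by intro i; cases i <;> simp [hA, (hapos _).ne']
  have hA_ge : ∀ i, δ₀ ≤ |A i| := fun i ↦ by rw [hA_abs]; exact hge _
  have hW_eq : ∀ i, W i = w (Sum.elim id id i) := by intro i; cases i <;> simp [hW]
  have hW0 : ∀ i, 0 ≤ W i := fun i ↦ by rw [hW_eq]; exact hw0 _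
  -- density inputs for the weights `W i * A i⁴`
  have hexp4 : Summable fun i ↦ W i * A i ^ 4 * Real.exp (δ * |A i|) := by
    have h : ∀ i, W i * A i ^ 4 * Real.exp (δ * |A i|) =
        (fun k ↦ w k * (a k ^ 4 * Real.exp (δ * a k))) (Sum.elim id id i) := by
      intro i
      rw [hW_eq, show A i ^ 4 = (A i ^ 2) ^ 2 by ring, hA_sq, hA_abs]
      simp only; ring
    rw [show (fun i ↦ W i * A i ^ 4 * Real.exp (δ * |A i|)) =
      fun i ↦ (fun k ↦ w k * (a k ^ 4 * Real.exp (δ * a k))) (Sum.elim id id i) from funext h]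
    exact Summable.sum _ (by simpa [Function.comp_def] using hexp 4)
      (by simpa [Function.comp_def] using hexp 4)
  have hsumW : Summable W := by
    have h := summable_weight_abs_pow hw0 ha0 hδ.le hexp 0
    simpa [hW] using h
  have hG : Summable fun i ↦ W i * A i ^ 4 * (1 / A i ^ 2) ^ 2 := by
    refine hsumW.congr fun i ↦ ?_
    have := hA_ne i
    field_simp
  rw [Metric.tendsto_atTop]
  intro ε hε
  have hε' : 0 < ε ^ 2 * w k₀ := mul_pos (pow_pos hε 2) (hw k₀)
  obtain ⟨T, -, hTlt⟩ := Literature.Analysis.Moments.exists_polynomial_approx A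
    (fun i ↦ W i * A i ^ 4) (fun i ↦ mul_nonneg (hW0 i) (by positivity)) hδ hexp4
    (fun x ↦ 1 / x ^ 2) hG hε'
  refine ⟨T.natDegree + 1, fun n hn ↦ ?_⟩
  have hT : T.degree < (2 * n : ℕ) :=
    lt_of_le_of_lt degree_le_natDegree (by exact_mod_cast (show T.natDegree < 2 * n by omega))
  have hB2 := CardonRobertsOP.integral_oddRatio_sq_le hmom hae hsym hδ₀ hgap n T hT
  set p := cardonRobertsPoly μ (2 * n + 1) with hp
  obtain ⟨-, -, -, -, -, -, hp0, -⟩ := CardonRobertsOP.exists_oddRatio_eq_prod hmom hae hsym n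
  have hsumL : Summable fun i : κ ⊕ κ ↦ Sum.elim w w i *
      |(fun x : ℝ ↦ (p.eval x / (x * (derivative p).eval 0)) ^ 2) (Sum.elim a (fun k ↦ -a k) i)| := by
    have hq := summable_weight_abs_eval hw0 ha0 hδ.le hexp (p ^ 2)
    refine (hq.mul_left (1 / (δ₀ * (derivative p).eval 0) ^ 2)).of_nonneg_of_le
      (fun i ↦ mul_nonneg (hW0 i) (abs_nonneg _)) fun i ↦ ?_
    show W i * |(p.eval (A i) / (A i * (derivative p).eval 0)) ^ 2| ≤
      1 / (δ₀ * (derivative p).eval 0) ^ 2 * (W i * |(p ^ 2).eval (A i)|)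
    rw [abs_of_nonneg (sq_nonneg _), eval_pow, abs_of_nonneg (sq_nonneg _), div_pow]
    have h1 : (δ₀ * (derivative p).eval 0) ^ 2 ≤ (A i * (derivative p).eval 0) ^ 2 := by
      rw [mul_pow, mul_pow, ← sq_abs (A i)]
      exact mul_le_mul_of_nonneg_right (pow_le_pow_left₀ hδ₀.le (hA_ge i) 2) (sq_nonneg _)
    have h2 : 0 < (δ₀ * (derivative p).eval 0) ^ 2 := by positivity
    rw [show 1 / (δ₀ * (derivative p).eval 0) ^ 2 * (W i * p.eval (A i) ^ 2) =
      W i * (p.eval (A i) ^ 2 / (δ₀ * (derivative p).eval 0) ^ 2) by ring]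
    refine mul_le_mul_of_nonneg_left ?_ (hW0 i)
    exact div_le_div_of_nonneg_left (sq_nonneg _) h2 h1
  have hleft := weight_mul_le_integral hμ hw0
    (fun x : ℝ ↦ (p.eval x / (x * (derivative p).eval 0)) ^ 2) (fun x ↦ sq_nonneg _) hsumL k₀
  have hright : ∫ x, (1 - x ^ 2 * T.eval x) ^ 2 ∂μ =
      ∑' i, W i * A i ^ 4 * (1 / A i ^ 2 - T.eval (A i)) ^ 2 := by
    rw [integral_eq_tsum hμ hw0]
    refine tsum_congr fun i ↦ ?_
    have hAi : Sum.elim a (fun k ↦ -a k) i ≠ 0 := hA_ne i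
    simp only [hW, hA]
    field_simp
  have hchain : w k₀ * (p.eval (a k₀) / (a k₀ * (derivative p).eval 0)) ^ 2 < ε ^ 2 * w k₀ := by
    refine lt_of_le_of_lt (hleft.trans hB2) ?_
    rw [hright]
    exact hTlt
  have hwk := hw k₀
  have hsq : (p.eval (a k₀) / (a k₀ * (derivative p).eval 0)) ^ 2 < ε ^ 2 := by
    rw [mul_comm (ε ^ 2)] at hchain
    exact lt_of_mul_lt_mul_left hchain hwk.le
  rw [dist_zero_right, Real.norm_eq_abs]
  exact abs_lt_of_sq_lt_sq hsq hε.le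

end Vanishing

end CardonRobertsAssembly

/-! ## §4 Assembly -/

open CardonRobertsAssembly in
/-- **Cardon–Roberts 2006, Lemma 3.5 — DISCHARGED** (Broughan Vol. 2 Thm 6.16's convergence
statement): for every admissible `f`, the Gram–Schmidt polynomials `p_n` of
`dF = Σ_k m_k Re f(ρ_k)(δ_{α_k} + δ_{−α_k})` satisfy `p_{2n}(z)/p_{2n}(0) → ∏_k (1 − z²/α_k²)`
uniformly on compact subsets of `ℂ`, and `p_{2n+1}(z)/(z p'_{2n+1}(0)) → ∏_k (1 − z²/α_k²)` for
`z ≠ 0`. Road: B1 (real simple symmetric zeros, (17)) + B2 (CR Lemma 3.3 in counting form and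
the `L²`-extremal inequalities) + C (polynomial density under the exponential moment supplied by
`|f| < e^{−c x}` and `Σ m(ρ)/|ρ|² < ∞`) + D (CR Lemmas 3.4–3.5 abstractly); the zeta inputs are
`riemannXi_eq_zero_iff_holds`, `FordL33.fourteen_lt_abs_im`, `untop₀_meromorphicOrderAt_riemannXi`,
`FordL33.summable_order_div_norm_sq`, Hardy's theorem and `zetaZeroBox_finite`. RH-FREE.
[cite: CardonRoberts2006, Lemma 3.5 pp. 62–63; Broughan2017, Vol. 2 Thm 6.16] -/
theorem CardonRoberts2006_lemma_3_5_holds : CardonRoberts2006_lemma_3_5 := by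
  intro f hf
  classical
  haveI : Countable cardonRobertsZeros := countable_cardonRobertsZeros.to_subtype
  obtain ⟨c, hc, hcf⟩ := hf.decay
  set μ := cardonRobertsMeasure f with hμdef
  set w : cardonRobertsZeros → ℝ := fun z ↦
    (analyticOrderNatAt riemannXiUpper (z : ℂ) : ℝ) * (f z).re with hw_def
  set a : cardonRobertsZeros → ℝ := fun z ↦ (z : ℂ).re with ha_def
  have hμ : μ = Measure.sum fun k ↦
      ENNReal.ofReal (w k) • (Measure.dirac (a k) + Measure.dirac (-a k)) := rfl
  have hw : ∀ k, 0 < w k := fun k ↦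
    mul_pos (by exact_mod_cast one_le_analyticOrderNatAt k.2) (hf.re_pos _ (mem_strip k.2))
  have hge : ∀ k, (14 : ℝ) ≤ a k := fun k ↦ (fourteen_lt_re k.2).le
  have hexp : ∀ j : ℕ, Summable fun k ↦ w k * (a k ^ j * Real.exp (c / 2 * a k)) :=
    fun j ↦ summable_weight_pow_exp hf hc hcf j
  have hrange : Set.range a = cardonRobertsSpectrum := by
    ext x
    constructor
    · rintro ⟨⟨z, hz⟩, rfl⟩; exact ⟨z, hz, rfl⟩
    · rintro ⟨z, hz, rfl⟩; exact ⟨⟨z, hz⟩, rfl⟩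
  have hinf : (Set.range a).Infinite := by rw [hrange]; exact spectrum_infinite
  have hw0 : ∀ k, 0 ≤ w k := fun k ↦ (hw k).le
  have ha0 : ∀ k, 0 ≤ a k := fun k ↦ le_trans (by norm_num) (hge k)
  have h14 : (0 : ℝ) < 14 := by norm_num
  have hmom := integrable_pow hμ hw0 ha0 (half_pos hc).le hexp
  have hae := eq_zero_of_eval_ae_eq_zero hμ hw hinf
  have hsym := integral_eval_neg hμ hw0
  have hS : ∀ᵐ y ∂μ, |y| ∈ cardonRobertsSpectrum := by
    rw [← hrange]; exact ae_abs_mem_range hμ ha0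
  have hSpos : ∀ x ∈ cardonRobertsSpectrum, 0 < x := fun x hx ↦
    lt_trans h14 (fourteen_lt_of_mem_spectrum hx)
  -- the positive zero sets of `p_{2n}` and `p_{2n+1}` (layer B1)
  choose Z hZ using fun n ↦ CardonRobertsOP.exists_evenRatio_eq_prod hmom hae hsym n
  choose Z' hZ' using fun n ↦ CardonRobertsOP.exists_oddRatio_eq_prod hmom hae hsym n
  -- vanishing at the spectrum (§3), in product form
  have hpt_even : ∀ x ∈ cardonRobertsSpectrum,
      Tendsto (fun n ↦ ∏ y ∈ Z n, (1 - x ^ 2 / y ^ 2)) atTop (𝓝 0) := by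
    intro x hx
    rw [← hrange] at hx
    obtain ⟨k₀, rfl⟩ := hx
    refine (tendsto_even_ratio hμ hw h14 hge (half_pos hc) hexp hinf k₀).congr fun n ↦ ?_
    obtain ⟨-, hpos, -, hprod, -, -⟩ := hZ n
    rw [hprod, CardonRobertsOP.eval_prod_X_sq_sub, CardonRobertsOP.eval_zero_prod_X_sq_sub,
      ← Finset.prod_div_distrib]
    refine Finset.prod_congr rfl fun y hy ↦ ?_
    have hy0 : y ≠ 0 := (hpos y hy).ne'
    field_simp
    ring
  have hpt_odd : ∀ x ∈ cardonRobertsSpectrum,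
      Tendsto (fun n ↦ ∏ y ∈ Z' n, (1 - x ^ 2 / y ^ 2)) atTop (𝓝 0) := by
    intro x hx
    rw [← hrange] at hx
    obtain ⟨k₀, rfl⟩ := hx
    refine (tendsto_odd_ratio hμ hw h14 hge (half_pos hc) hexp hinf k₀).congr fun n ↦ ?_
    obtain ⟨-, hpos, -, hprod, hder, -, -⟩ := hZ' n
    have hak : a k₀ ≠ 0 := (lt_of_lt_of_le h14 (hge k₀)).ne'
    rw [hder, hprod, eval_mul, eval_X, CardonRobertsOP.eval_prod_X_sq_sub,
      mul_div_mul_left _ _ hak, ← Finset.prod_div_distrib]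
    refine Finset.prod_congr rfl fun y hy ↦ ?_
    have hy0 : y ≠ 0 := (hpos y hy).ne'
    field_simp
    ring
  -- separation (CR Lemma 3.3, layer B2)
  have hsep_even : ∀ n (t : ℝ) (F : Finset ℝ), (∀ x ∈ cardonRobertsSpectrum, x < t → x ∈ F) →
      ((Z n).filter (· ≤ t)).card ≤ (F.filter (fun x ↦ 0 ≤ x ∧ x < t)).card :=
    fun n t F hF ↦ CardonRobertsOP.card_filter_le_even hmom hae (hZ n).2.1 (hZ n).1
      (hZ n).2.2.2.1 hS t F hF
  have hsep_odd : ∀ n (t : ℝ) (F : Finset ℝ), (∀ x ∈ cardonRobertsSpectrum, x < t → x ∈ F) →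
      ((Z' n).filter (· ≤ t)).card ≤ (F.filter (fun x ↦ 0 ≤ x ∧ x < t)).card :=
    fun n t F hF ↦ CardonRobertsOP.card_filter_le_odd hmom hae (hZ' n).2.1 (hZ' n).1
      (hZ' n).2.2.2.1 hS t F hF
  -- layer D
  have hEven := CardonRobertsLimit.tendstoLocallyUniformly_prod hSpos spectrum_infinite
    spectrum_inter_Iic_finite summable_spectrum_inv_sq Z hsep_even hpt_even
  have hOdd := CardonRobertsLimit.tendstoLocallyUniformly_prod hSpos spectrum_infinite
    spectrum_inter_Iic_finite summable_spectrum_inv_sq Z' hsep_odd hpt_odd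
  refine ⟨?_, fun z hz ↦ ?_⟩
  · have hfun : (fun (n : ℕ) (z : ℂ) ↦ cardonRobertsEvenRatio μ n z) =
        fun n z ↦ ∏ y ∈ Z n, (1 - z ^ 2 / (y : ℂ) ^ 2) := by
      funext n z
      exact (hZ n).2.2.2.2.2 z
    rw [hfun]
    exact hEven
  · have h1 := (hOdd.tendstoLocallyUniformlyOn (s := Set.univ)).tendsto_at (Set.mem_univ z)
    refine h1.congr fun n ↦ ?_
    exact ((hZ' n).2.2.2.2.2.2 z hz).symm

end Literature.NumberTheory.LFunctions

end
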